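import Mathlib.Algebra.Polynomial.Taylor
import Mathlib.Analysis.Analytic.IsolatedZeros
import Mathlib.Order.Filter.AtTopBot.Archimedean
import Literature.NumberTheory.Transcendental.NormDescentConstantShadow
import HarnessLib

/-!
# Norm descent along an integer sequence of denominators

Sequence versions of the pocket lemmas behind the residual cusp atoms of the crux
`RigidCore.SparsityTwo` (line cusp-germ-schneider-sparsity, stub `stub_deepCuspFinite`): the
hits of a linear torsion cusp live on an arithmetic progression `M n = q n + m₁` of denominators
rather than on all of `ℕ`, and the tail limit exists only ALONG that progression, so the tree
lemma `finite_setOf_slope_hit_of_normLimit` (file `NormDescentConstantShadow`) is re-run with the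
denominator `N` replaced by an arbitrary integer sequence `M n → +∞`.

* `finite_setOf_slope_hit_of_normLimit_seq` — `f ∈ ℤ[X]` without rational roots, `β ∈ ℝ` a
  simple root, `d = deg f`, `(M n)^{d-1} · r n → κ` with `κ` zero-or-transcendental
  (`IsAlgebraic ℚ κ → κ = 0`): then `β · M n + r n ∈ ℤ` for only finitely many `n`. Proof: at a
  hit `L − β M = r =: ε`; the INTEGER `M^d f(L/M)` equals, by Taylor expansion of `f` at `β`,
  `Σ_{j≥1} (f^{(j)}(β)/j!) εʲ M^{d−j} → f'(β) κ`; an eventually-integral convergent sequence is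
  eventually constant `= k ∈ ℤ` (`exists_int_eq_of_tendsto_of_frequently`); `k ≠ 0` makes
  `κ = k/f'(β)` algebraic non-zero, `k = 0` makes `L/M` a rational root.
* `eventually_zero_of_infinite_ratSlope_hits` — RATIONAL slope `b₀`: if `b₀ · M n + g (t n) ∈ ℤ`
  for infinitely many `n`, with `g` analytic at `0`, `g 0 = 0` and `t n → 0` avoiding `0`, then
  `g ≡ 0` near `0`: the integers `den(b₀) · g (t n)` tend to `0`, hence vanish at all large hits,
  and the identity theorem concludes.
* `eq_zero_of_isAlgebraic_of_mul_pi_pow` — a number `κ` with `κ · π^d ∈ ℚ̄`, `d ≥ 1`, is zero or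
  transcendental (Lindemann, tree theorem `transcendental_pi_holds`): the shape of the limits
  `q^d φ / ((e(d−1))! (2πi)^d)` met at the cusps.
[folklore]

## References

* [folklore] elementary Galois-norm / bounded-norm argument, cf. D'Aquino–Macintyre–Terzo
  arXiv:1206.6747 §3; Lindemann 1882 for `π`.
-/

noncomputable section

open Filter Polynomial
open _root_.Topology

namespace Literature.NumberTheory.Transcendental

/-- The inverse of an integer sequence tending to `+∞` tends to `0` in `ℂ`. [folklore] -/
theorem tendsto_inv_intCast_of_tendsto_atTop {M : ℕ → ℤ} (hM : Tendsto M atTop atTop) :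
    Tendsto (fun n => ((M n : ℂ))⁻¹) atTop (𝓝 0) := by
  have h1 : Tendsto (fun n => ((M n : ℤ) : ℝ)) atTop atTop := tendsto_intCast_atTop_atTop.comp hM
  have h2 := (Complex.continuous_ofReal.tendsto 0).comp h1.inv_tendsto_atTop
  rw [Complex.ofReal_zero] at h2
  refine h2.congr fun n => ?_
  simp only [Function.comp_apply, Pi.inv_apply, Complex.ofReal_inv, Complex.ofReal_intCast]

/-- **Norm descent with constant shadow, along an integer sequence of denominators.** Let
`f ∈ ℤ[X]` have no rational root, `β ∈ ℝ` with `f(β) = 0 ≠ f'(β)`, `d = natDegree f`; let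
`M : ℕ → ℤ` tend to `+∞`, `r : ℕ → ℂ` and `κ ∈ ℂ` with `(M n)^{d-1} r n → κ` and `κ`
zero-or-transcendental (`IsAlgebraic ℚ κ → κ = 0`). Then `{n | β · M n + r n ∈ ℤ}` is finite.
[folklore] -/
theorem finite_setOf_slope_hit_of_normLimit_seq {β : ℝ} {f : ℤ[X]}
    (hnorat : ∀ q : ℚ, aeval (q : ℝ) f ≠ 0) (hroot : aeval β f = 0)
    (hsimple : aeval β (derivative f) ≠ 0) {M : ℕ → ℤ} (hM : Tendsto M atTop atTop)
    {r : ℕ → ℂ} {κ : ℂ}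
    (hr : Tendsto (fun n : ℕ => (M n : ℂ) ^ (f.natDegree - 1) * r n) atTop (𝓝 κ))
    (hκ : IsAlgebraic ℚ κ → κ = 0) :
    Set.Finite {n : ℕ | ∃ L : ℤ, (β : ℂ) * (M n) + r n = L} := by
  classical
  set d := f.natDegree with hd
  -- `f ≠ 0`, `d ≥ 1`
  have hf0 : f ≠ 0 := by rintro rfl; exact hsimple (by simp)
  have hdpos : 0 < d := by
    rw [hd]
    by_contra h0
    push Not at h0
    have h0' : f.natDegree = 0 := Nat.le_zero.mp h0
    have := hsimple
    rw [Polynomial.eq_C_of_natDegree_eq_zero h0', derivative_C, map_zero] at this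
    exact this rfl
  -- `M n ≥ 1` eventually, `(M n)⁻¹ → 0`
  have hMpos : ∀ᶠ n in atTop, 0 < M n := hM.eventually_gt_atTop 0
  have hMinv : Tendsto (fun n => ((M n : ℂ))⁻¹) atTop (𝓝 0) :=
    tendsto_inv_intCast_of_tendsto_atTop hM
  -- complexified polynomial and its Taylor expansion at `β`
  set fC : ℂ[X] := f.map (Int.castRingHom ℂ) with hfC
  have hfCdeg : fC.natDegree = d := by
    rw [hfC, natDegree_map_eq_of_injective (RingHom.injective_int (Int.castRingHom ℂ)), hd]
  have haevalC : ∀ (p : ℤ[X]), aeval (β : ℂ) p = ((aeval β p : ℝ) : ℂ) := fun p => by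
    rw [← Complex.coe_algebraMap, Polynomial.aeval_algebraMap_apply]
  have hfCβ : fC.eval (β : ℂ) = 0 := by
    have : fC.eval (β : ℂ) = aeval (β : ℂ) f := by
      rw [hfC, eval_map, aeval_def]; rfl
    rw [this, haevalC, hroot, Complex.ofReal_zero]
  set g : ℂ[X] := taylor (β : ℂ) fC with hg
  have hg0 : g.coeff 0 = 0 := by rw [hg, taylor_coeff_zero, hfCβ]
  have hg1 : g.coeff 1 = aeval (β : ℂ) (derivative f) := by
    rw [hg, taylor_coeff_one, hfC, derivative_map, eval_map, aeval_def]; rfl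
  have hg1ne : g.coeff 1 ≠ 0 := by
    rw [hg1, haevalC]; exact_mod_cast hsimple
  have hgdeg : g.natDegree = d := by rw [hg, natDegree_taylor, hfCdeg]
  have htaylor : ∀ x : ℂ, fC.eval x = g.eval (x - β) := fun x => by
    rw [hg, taylor_eval, sub_add_cancel]
  -- the hit-free model sequence and its limit `g₁ κ`
  set a : ℕ → ℂ := fun n =>
    ∑ j ∈ Finset.range (d + 1), g.coeff j * (r n) ^ j * (M n : ℂ) ^ (d - j) with ha
  have halim : Tendsto a atTop (𝓝 (g.coeff 1 * κ)) := by
    have hterm : ∀ j ∈ Finset.range (d + 1), Tendsto (fun n : ℕ => g.coeff j * (r n) ^ j *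
        (M n : ℂ) ^ (d - j)) atTop (𝓝 (if j = 1 then g.coeff 1 * κ else 0)) := by
      intro j hj
      rw [Finset.mem_range] at hj
      rcases Nat.lt_trichotomy j 1 with h | rfl | h
      · -- `j = 0`: the term is `g₀ M^d = 0`
        have hj0 : j = 0 := by omega
        subst hj0
        simp only [hg0, zero_mul, if_neg (Nat.zero_ne_one)]
        exact tendsto_const_nhds
      · -- `j = 1`
        simp only [if_true, pow_one]
        have := hr.const_mul (g.coeff 1)
        refine this.congr fun n => ?_
        ring
      · -- `j ≥ 2`: `(M^{d-1} r)^j / M^{d(j-1)} → κ^j · 0`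
        rw [if_neg (by omega)]
        have hpow : Tendsto (fun n : ℕ => ((M n : ℂ) ^ (d * (j - 1)))⁻¹) atTop (𝓝 0) := by
          have h2 := hMinv.pow (d * (j - 1))
          rw [zero_pow (Nat.pos_iff_ne_zero.mp (Nat.mul_pos hdpos (by omega)))] at h2
          refine h2.congr fun n => ?_
          rw [inv_pow]
        have h3 := ((hr.pow j).mul hpow).const_mul (g.coeff j)
        rw [mul_zero, mul_zero] at h3
        refine h3.congr' ?_
        filter_upwards [hMpos] with n hn
        have hN : (M n : ℂ) ≠ 0 := Int.cast_ne_zero.mpr hn.ne'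
        have hexp : (d - 1) * j = (d - j) + d * (j - 1) := by
          have h1 : 1 ≤ d := hdpos
          have h2 : j ≤ d := by omega
          zify [h1, h2, (by omega : 1 ≤ j)]
          ring
        rw [mul_pow, ← pow_mul, hexp, pow_add]
        field_simp
    have := tendsto_finsetSum (Finset.range (d + 1)) hterm
    rw [Finset.sum_ite_eq' (Finset.range (d + 1)) 1 (fun _ => g.coeff 1 * κ),
      if_pos (Finset.mem_range.mpr (by omega))] at this
    exact this
  -- at a hit `n` with `M n ≥ 1` and value `L`, `a n` is the INTEGER `M^d f(L/M) = Σ f_i L^i M^{d-i}`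
  have hmodel : ∀ (n : ℕ), 0 < M n → ∀ (L : ℤ), (β : ℂ) * (M n) + r n = L →
      a n = (M n : ℂ) ^ d * fC.eval ((L : ℂ) / (M n)) := by
    intro n hn L hL
    have hN : (M n : ℂ) ≠ 0 := Int.cast_ne_zero.mpr hn.ne'
    have hε : r n = (L : ℂ) - (β : ℂ) * (M n) := by linear_combination hL
    have h1 : a n = (M n : ℂ) ^ d * g.eval (r n / (M n)) := by
      rw [eval_eq_sum_range, hgdeg, Finset.mul_sum, ha]
      refine Finset.sum_congr rfl fun j hj => ?_
      rw [Finset.mem_range] at hj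
      rw [div_pow]
      have : (M n : ℂ) ^ d = (M n : ℂ) ^ (d - j) * (M n : ℂ) ^ j := by
        rw [← pow_add, Nat.sub_add_cancel (by omega)]
      rw [this]
      field_simp
    have h2 : g.eval (r n / (M n)) = fC.eval ((L : ℂ) / (M n)) := by
      rw [htaylor, hε]
      congr 1
      field_simp
    rw [h1, h2]
  have hint : ∀ (n : ℕ), 0 < M n → ∀ (L : ℤ), (β : ℂ) * (M n) + r n = L →
      a n = ((∑ i ∈ Finset.range (d + 1), f.coeff i * L ^ i * (M n) ^ (d - i) : ℤ) : ℂ) := by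
    intro n hn L hL
    have hN : (M n : ℂ) ≠ 0 := Int.cast_ne_zero.mpr hn.ne'
    rw [hmodel n hn L hL, eval_eq_sum_range, hfCdeg, Finset.mul_sum]
    push_cast
    refine Finset.sum_congr rfl fun i hi => ?_
    rw [Finset.mem_range] at hi
    rw [hfC, coeff_map, div_pow]
    have : (M n : ℂ) ^ d = (M n : ℂ) ^ (d - i) * (M n : ℂ) ^ i := by
      rw [← pow_add, Nat.sub_add_cancel (by omega)]
    rw [this, eq_intCast]
    field_simp
  by_contra hinf
  have hfreqS : ∃ᶠ n : ℕ in atTop, ∃ L : ℤ, (β : ℂ) * (M n) + r n = L :=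
    Nat.frequently_atTop_iff_infinite.mpr (Set.not_finite.mp hinf)
  have hfreqa : ∃ᶠ n : ℕ in atTop, ∃ K : ℤ, a n = K := by
    refine (hMpos.and_frequently hfreqS).mono fun n hn => ?_
    obtain ⟨hNpos, L, hL⟩ := hn
    exact ⟨_, hint n hNpos L hL⟩
  obtain ⟨k, hk, hevk⟩ := exists_int_eq_of_tendsto_of_frequently halim hfreqa
  by_cases hk0 : k = 0
  · -- the norm vanishes at a large hit: a rational root of `f`
    subst hk0
    obtain ⟨n, ⟨hNpos, hNk⟩, L, hL⟩ := ((hMpos.and hevk).and_frequently hfreqS).exists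
    have hN : (M n : ℂ) ≠ 0 := Int.cast_ne_zero.mpr hNpos.ne'
    have haN : a n = 0 := by
      have := hNk _ (hint n hNpos L hL)
      rw [hint n hNpos L hL, this, Int.cast_zero]
    have h1 : (M n : ℂ) ^ d * fC.eval ((L : ℂ) / (M n)) = 0 := by
      rw [← hmodel n hNpos L hL, haN]
    have h2 : fC.eval ((L : ℂ) / (M n)) = 0 :=
      (mul_eq_zero.mp h1).resolve_left (pow_ne_zero _ hN)
    apply hnorat ((L : ℚ) / (M n : ℚ))
    set q : ℚ := (L : ℚ) / (M n : ℚ) with hq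
    have h3 : aeval ((q : ℝ) : ℂ) f = 0 := by
      rw [Complex.ofReal_ratCast, aeval_def, ← eval_map,
        show algebraMap ℤ ℂ = Int.castRingHom ℂ from rfl, ← hfC]
      have : ((q : ℚ) : ℂ) = (L : ℂ) / (M n) := by rw [hq]; push_cast; ring
      rw [this, h2]
    rw [← Complex.coe_algebraMap, Polynomial.aeval_algebraMap_apply, Complex.coe_algebraMap,
      Complex.ofReal_eq_zero] at h3
    exact h3
  · -- `κ = k / g₁` would be algebraic and non-zero
    have hκeq : κ = (k : ℂ) / g.coeff 1 := by
      rw [hk]; field_simp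
    have hβalg : IsAlgebraic ℚ (β : ℂ) := by
      refine ⟨f.map (algebraMap ℤ ℚ), ?_, ?_⟩
      · exact (Polynomial.map_ne_zero_iff (algebraMap ℤ ℚ).injective_int).mpr hf0
      · rw [Polynomial.aeval_map_algebraMap, haevalC, hroot, Complex.ofReal_zero]
    have hg1alg : IsAlgebraic ℚ (g.coeff 1) := by
      rw [hg1, ← Polynomial.aeval_map_algebraMap ℚ]
      exact isAlgebraic_aeval_of_isAlgebraic hβalg _
    have hκalg : IsAlgebraic ℚ κ := by
      rw [hκeq, div_eq_mul_inv]
      exact (isAlgebraic_int k).mul (IsAlgebraic.inv_iff.mpr hg1alg)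
    have hκ0 : κ = 0 := hκ hκalg
    rw [hκeq, div_eq_zero_iff] at hκ0
    rcases hκ0 with h | h
    · exact hk0 (by exact_mod_cast h)
    · exact hg1ne h

/-- **Rational slope: an infinite hit set forces a vanishing tail.** If `b₀ ∈ ℚ`,
`M : ℕ → ℤ`, `g` is analytic at `0` with `g 0 = 0`, the sample points `t n` tend to `0`
avoiding `0`, and `b₀ · M n + g (t n) ∈ ℤ` for infinitely many `n`, then `g ≡ 0` near `0`.
[folklore] -/
theorem eventually_zero_of_infinite_ratSlope_hits {b₀ : ℚ} {M : ℕ → ℤ} {g : ℂ → ℂ}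
    {t : ℕ → ℂ} (hg : AnalyticAt ℂ g 0) (hg0 : g 0 = 0) (ht : Tendsto t atTop (𝓝[≠] 0))
    (hinf : Set.Infinite {n : ℕ | ∃ L : ℤ, (b₀ : ℂ) * (M n) + g (t n) = L}) :
    ∀ᶠ z in 𝓝 (0 : ℂ), g z = 0 := by
  have ht0 : Tendsto t atTop (𝓝 0) := ht.mono_right nhdsWithin_le_nhds
  -- `g (t n) → 0`
  have hg' : Tendsto (fun n => g (t n)) atTop (𝓝 0) := by
    have h := hg.continuousAt.tendsto.comp ht0
    rwa [hg0] at h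
  set D : ℕ := b₀.den with hD
  have hD0 : (D : ℂ) ≠ 0 := Nat.cast_ne_zero.mpr b₀.den_nz
  have hnum : (b₀ : ℂ) * (D : ℂ) = (b₀.num : ℂ) := by
    have h1 : ((b₀ * b₀.den : ℚ) : ℂ) = ((b₀.num : ℚ) : ℂ) := by rw [Rat.mul_den_eq_num]
    push_cast at h1
    exact h1
  -- `D * g (t n) → 0`, so eventually `‖D * g (t n)‖ < 1`
  have hsmall : ∀ᶠ n in atTop, ‖(D : ℂ) * g (t n)‖ < 1 := by
    have h := (hg'.const_mul (D : ℂ)).norm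
    rw [mul_zero, norm_zero] at h
    exact h.eventually (gt_mem_nhds one_pos)
  -- at a hit, `D * g (t n)` is an integer, hence zero once it is small
  have hzero : ∀ᶠ n in atTop, (∃ L : ℤ, (b₀ : ℂ) * (M n) + g (t n) = L) → g (t n) = 0 := by
    filter_upwards [hsmall] with n hn hhit
    obtain ⟨L, hL⟩ := hhit
    have hK : (D : ℂ) * g (t n) = ((D * L - b₀.num * M n : ℤ) : ℂ) := by
      push_cast
      linear_combination (D : ℂ) * hL - (M n : ℂ) * hnum
    have hK0 : (D * L - b₀.num * M n : ℤ) = 0 := by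
      refine Int.eq_of_norm_cast_sub_lt_one ?_
      rw [Int.cast_zero, sub_zero, ← hK]
      exact hn
    have : (D : ℂ) * g (t n) = 0 := by rw [hK, hK0, Int.cast_zero]
    exact (mul_eq_zero.mp this).resolve_left hD0
  have hfreq : ∃ᶠ n : ℕ in atTop, ∃ L : ℤ, (b₀ : ℂ) * (M n) + g (t n) = L :=
    Nat.frequently_atTop_iff_infinite.mpr hinf
  have hfreq0 : ∃ᶠ z in 𝓝[≠] (0 : ℂ), g z = 0 := ht.frequently (hfreq.mp hzero)
  exact hg.frequently_zero_iff_eventually_zero.mp hfreq0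

/-- **Algebraic multiples of `π^{-d}` are zero or transcendental** (`d ≥ 1`): if `κ · π^d` is
algebraic and `κ` is algebraic then `κ = 0` (otherwise `π^d`, hence `π`, would be algebraic,
contradicting Lindemann's theorem, tree `transcendental_pi_holds`). [folklore] -/
theorem eq_zero_of_isAlgebraic_of_mul_pi_pow {κ : ℂ} {d : ℕ} (hd : 0 < d)
    (hprod : IsAlgebraic ℚ (κ * (Real.pi : ℂ) ^ d)) (hκ : IsAlgebraic ℚ κ) : κ = 0 := by
  by_contra hne
  have hpid : IsAlgebraic ℚ ((Real.pi : ℂ) ^ d) := by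
    have : (Real.pi : ℂ) ^ d = (κ * (Real.pi : ℂ) ^ d) * κ⁻¹ := by field_simp
    rw [this]
    exact hprod.mul (IsAlgebraic.inv_iff.mpr hκ)
  have hpiC : IsAlgebraic ℚ (Real.pi : ℂ) := hpid.of_pow hd
  have hpiR : IsAlgebraic ℚ Real.pi :=
    (isAlgebraic_algebraMap_iff (R := ℚ) (A := ℂ) (algebraMap ℝ ℂ).injective).mp hpiC
  exact transcendental_pi_holds hpiR

end Literature.NumberTheory.Transcendental

end
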